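import Literature.Computability.QuantumComplexity.GluedTreesThm9EmbBasic
import HarnessLib
/-!
# Glued trees, Theorem 9 (classical lower bound) — XI: the two "deferred decision" bounds of Lemma 8 (ii)

Theorem-only support file for `ChildsEtAl2003_thm9`. Part (ii) of the printed Lemma 8 (p. 13)
argues that each crossing of the random cycle lands in a nearly uniform place ("the probability
that the last terms on the two lists agree is bounded by `2^{n/2}/(2^n - t)`, by the construction
of the random cycle"). The rigorous versions, by double counting with transpositions of the
cycle datum `σ = (e, f)` that leave every READ slot unchanged (`GluedTreesThm9EmbDet`):

* `card_badSpread_mul_le`: the SLOT of a newly read leaf is nearly uniform among unread slots —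
  `#{(c,σ) : ∃ j, BadSpread} · (2^n - 3t - 1) ≤ E · 2 · 3t(4t+9) · 2^t · |Σ|`;
* `card_badBlock_mul_le`: the LEAF in a newly read slot is nearly uniform among unread leaves —
  `#{(c,σ) : ∃ j, BadBlock} · (2^n - 3t - 2) ≤ E · 3 · (4t+3) · 2^(h-1) · 2^t · |Σ|`.

## References

* [ChildsEtAl2003] A. M. Childs et al., Exponential algorithmic speedup by a quantum walk,
  STOC 2003, §4, Lemma 8 (ii).
-/

open Literature.Computability.Complexity

namespace Literature.Computability.QuantumComplexity

namespace GluedTrees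

open Finset
open scoped Classical

variable {n : ℕ}

/-! ### Small slot facts -/

/-- `slotPos (2k) = k`. [folklore] -/
theorem slotPos_two_mul (k : Fin (2 ^ n)) : slotPos (((2 * (k : ℕ) : ℕ) : Slot n)) = k := by
  apply Fin.ext
  show ((2 * (k : ℕ) : ℕ) : Slot n).val / 2 = k
  rw [ZMod.val_natCast_of_lt (by rw [Nat.pow_succ']; omega)]
  omega

/-- `slotPos (2k+1) = k`. [folklore] -/
theorem slotPos_two_mul_add_one (k : Fin (2 ^ n)) : slotPos (((2 * (k : ℕ) + 1 : ℕ) : Slot n)) = k := by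
  apply Fin.ext
  show ((2 * (k : ℕ) + 1 : ℕ) : Slot n).val / 2 = k
  rw [ZMod.val_natCast_of_lt (by rw [Nat.pow_succ']; omega)]
  omega

/-- An even slot is twice its position. [folklore] -/
theorem slot_eq_two_mul_of_even {s : Slot n} (hs : s.val % 2 = 0) : s = ((2 * (slotPos s : ℕ) : ℕ) : Slot n) := by
  conv_lhs => rw [slot_eq_two_mul_slotPos_add s]
  rw [hs, add_zero]

/-- An odd slot is twice its position plus one. [folklore] -/
theorem slot_eq_two_mul_add_one_of_odd {s : Slot n} (hs : s.val % 2 ≠ 0) :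
    s = ((2 * (slotPos s : ℕ) + 1 : ℕ) : Slot n) := by
  conv_lhs => rw [slot_eq_two_mul_slotPos_add s]
  have : s.val % 2 = 1 := by omega
  rw [this]

/-- The parity of the slot of a leaf is its side. [cite: ChildsEtAl2003, §2] -/
theorem slotOf_val_mod_two (σ : CycleDatum n) {v : Vertex n} (hv : depth v = n) :
    (slotOf σ v).val % 2 = if v.1 then 1 else 0 := by
  have := slotVal_fst σ (slotOf σ v)
  rw [slotVal_slotOf σ hv] at this
  cases hb : v.1 <;> rw [hb] at this <;> simp at this ⊢ <;> omega

/-- Counting pairs fibrewise. [folklore] -/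
theorem card_filter_prod_eq_sum {α β : Type*} (A : Finset α) (B : Finset β) (Q : α × β → Prop) [DecidablePred Q] :
    ((A ×ˢ B).filter Q).card = ∑ a ∈ A, (B.filter fun b ↦ Q (a, b)).card := by
  simp only [Finset.card_filter]
  rw [Finset.sum_product]

/-- Counting pairs (coins, `σ`) fibrewise over the coins. [folklore] -/
theorem card_filter_coins_eq_sum' (t : ℕ) (P : (Fin t → Bool) × CycleDatum n → Prop) [DecidablePred P] :
    (Finset.univ.filter P).card =
      ∑ c : Fin t → Bool, (Finset.univ.filter (fun σ : CycleDatum n ↦ P (c, σ))).card := by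
  simp only [Finset.card_filter]
  rw [Fintype.sum_prod_type]

/-- The slots within offset `D` of a given slot, as positions: at most `2D+1` of them. [folklore] -/
theorem card_near_le (y : Slot n) (D : ℕ) :
    ((Finset.Icc (-(D : ℤ)) D).image fun d : ℤ ↦ slotPos (y - (d : Slot n))).card ≤ 2 * D + 1 := by
  refine Finset.card_image_le.trans ?_
  rw [Int.card_Icc]
  omega

/-! ### The spread bound -/

/-- **A newly read leaf sits in a nearly uniform slot (one side, one step, fixed coins).** For a
valid list with `E ≤ t` expansions, coins `c`, a step `j` and a side `b`, the cycle data for which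
step `j` expands a node at a `b`-side leaf whose (unread) slot is within offset `2t+4` of a read
slot satisfy `#A · (2^n - 3t - 1) ≤ 3t(4t+9) · |Σ|`: re-randomising the position of that leaf by a
transposition with any unread position of the same side is invisible to the past.
[cite: ChildsEtAl2003, §4 (Lemma 8 (ii))] -/
theorem card_badSpread_side_mul_le (hn : 1 ≤ n) {par : List ℕ} (hval : ∀ i (h : i < par.length), par[i] ≤ 2 * i)
    (c : ℕ → Bool) {t : ℕ} (ht : par.length ≤ t) {j : ℕ} (hj : j < par.length) (b : Bool) :
    (Finset.univ.filter fun σ : CycleDatum n ↦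
        BadSpread σ par c t j ∧ (pos σ par c (par.getD j 0)).1 = b).card * (2 ^ n - (3 * t + 1)) ≤
      3 * t * (4 * t + 9) * (Finset.univ.filter fun σ : CycleDatum n ↦
        depth (pos σ par c (par.getD j 0)) = n ∧ (pos σ par c (par.getD j 0)).1 = b).card := by
  -- notation: the expanded node's position, its slot and position index
  set A := Finset.univ.filter (fun σ : CycleDatum n ↦
    BadSpread σ par c t j ∧ (pos σ par c (par.getD j 0)).1 = b) with hA
  have hpj : par.getD j 0 = par[j] := by
    rw [List.getD_eq_getElem?_getD, List.getElem?_eq_getElem hj]; rfl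
  have hp_le : par.getD j 0 ≤ 2 * j := by rw [hpj]; exact hval j hj
  -- the re-randomisation
  let T : CycleDatum n → Equiv.Perm (Fin (2 ^ n)) → CycleDatum n := fun σ τ ↦
    if b then (σ.1, τ.trans σ.2) else (τ.trans σ.1, σ.2)
  let perm : CycleDatum n → Equiv.Perm (Fin (2 ^ n)) := fun σ ↦ if b then σ.2 else σ.1
  let kOf : CycleDatum n → Fin (2 ^ n) := fun σ ↦ slotPos (slotOf σ (pos σ par c (par.getD j 0)))
  let slotk : Fin (2 ^ n) → Slot n := fun k ↦ ((2 * (k : ℕ) + (if b then 1 else 0) : ℕ) : Slot n)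
  have hslotk_inj : Function.Injective slotk := by
    intro k k' h
    have := (slot_natCast_inj (n := n) (by rw [Nat.pow_succ']; split_ifs <;> omega)
      (by rw [Nat.pow_succ']; split_ifs <;> omega)).mp h
    apply Fin.ext; omega
  have hslotk_pos : ∀ k, slotPos (slotk k) = k := by
    intro k; simp only [slotk]; cases b
    · simp only [Bool.false_eq_true, if_false, add_zero]; exact slotPos_two_mul k
    · simp only [if_true]; exact slotPos_two_mul_add_one k
  have hslotk_par : ∀ k, (slotk k).val % 2 = (if b then 1 else 0) := by
    intro k; simp only [slotk]
    rw [ZMod.val_natCast_of_lt (by rw [Nat.pow_succ']; split_ifs <;> omega)]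
    cases b <;> simp
  -- the slot of a leaf of side `b` is `slotk` of its position index
  have hslot_of_side : ∀ (σ : CycleDatum n) (v : Vertex n), depth v = n → v.1 = b → slotOf σ v = slotk (kOf σ) →
      slotVal σ (slotk (kOf σ)) = v := by
    intro σ v hv _ hx; rw [← hx, slotVal_slotOf σ hv]
  -- key facts for `σ ∈ A`
  have hAmem : ∀ σ ∈ A, depth (pos σ par c (par.getD j 0)) = n ∧ (pos σ par c (par.getD j 0)).1 = b ∧
      slotOf σ (pos σ par c (par.getD j 0)) = slotk (kOf σ) ∧
      slotk (kOf σ) ∉ revSlots σ par c j ∧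
      (∃ y ∈ revSlots σ par c j, ∃ d : ℤ, |d| ≤ 2 * t + 4 ∧ y = slotk (kOf σ) + d) := by
    intro σ hσ
    rw [hA, Finset.mem_filter] at hσ
    obtain ⟨-, ⟨hd, hnot, hy⟩, hside⟩ := hσ
    have hx : slotOf σ (pos σ par c (par.getD j 0)) = slotk (kOf σ) := by
      have hpar := slotOf_val_mod_two σ hd
      rw [hside] at hpar
      simp only [slotk, kOf]
      cases b
      · simp only [Bool.false_eq_true, if_false, add_zero] at hpar ⊢
        exact slot_eq_two_mul_of_even hpar
      · simp only [if_true] at hpar ⊢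
        exact slot_eq_two_mul_add_one_of_odd (by omega)
    refine ⟨hd, hside, hx, by rwa [← hx], ?_⟩
    rwa [← hx]
  -- re-randomising with an unread position is invisible
  have hinv : ∀ σ ∈ A, ∀ k' : Fin (2 ^ n), slotk k' ∉ revSlots σ par c j →
      (∀ m ≤ 2 * j, pos (T σ (Equiv.swap (kOf σ) k')) par c m = pos σ par c m) ∧
      revSlots (T σ (Equiv.swap (kOf σ) k')) par c j = revSlots σ par c j := by
    intro σ hσ k' hk'
    obtain ⟨hd, hside, hx, hnot, -⟩ := hAmem σ hσ
    have hfix : ∀ s ∈ revSlots σ par c j, s.val % 2 = (if b then 1 else 0) → Equiv.swap (kOf σ) k' (slotPos s) = slotPos s := by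
      intro s hs hpar
      have hs_eq : s = slotk (slotPos s) := by
        simp only [slotk]; cases b
        · simp only [Bool.false_eq_true, if_false, add_zero] at hpar ⊢; exact slot_eq_two_mul_of_even hpar
        · simp only [if_true] at hpar ⊢; exact slot_eq_two_mul_add_one_of_odd (by omega)
      apply Equiv.swap_apply_of_ne_of_ne
      · intro h; apply hnot; rw [← h, ← hs_eq]; exact hs
      · intro h; apply hk'; rw [← h, ← hs_eq]; exact hs
    have hagree : ∀ s ∈ revSlots σ par c j, slotVal (T σ (Equiv.swap (kOf σ) k')) s = slotVal σ s := by
      simp only [T]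
      cases b
      · simp only [Bool.false_eq_true, if_false]
        refine slotVal_preL_eq_of_fix σ _ _ fun s hs hpar ↦ hfix s hs ?_
        simp [hpar]
      · simp only [if_true]
        refine slotVal_preR_eq_of_fix σ _ _ fun s hs hpar ↦ hfix s hs ?_
        simp; omega
    obtain ⟨h1, h2⟩ := pos_revSlots_congr hn hval c σ _ j hj.le hagree
    exact ⟨h1, h2 j le_rfl⟩
  -- after re-randomisation the leaf sits at `slotk k'`
  have hnewslot : ∀ σ ∈ A, ∀ k' : Fin (2 ^ n),
      slotVal (T σ (Equiv.swap (kOf σ) k')) (slotk k') = pos σ par c (par.getD j 0) := by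
    intro σ hσ k'
    obtain ⟨hd, hside, hx, -, -⟩ := hAmem σ hσ
    have hv := hslot_of_side σ _ hd hside hx
    simp only [T]
    cases b
    · simp only [Bool.false_eq_true, if_false]
      rw [slotVal_preL, if_pos (by rw [hslotk_par]; simp), hslotk_pos, Equiv.swap_apply_right]
      rw [← hv]; unfold slotVal; rw [if_pos (by rw [hslotk_par]; simp), hslotk_pos]
    · simp only [if_true]
      rw [slotVal_preR, if_neg (by rw [hslotk_par]; simp), hslotk_pos, Equiv.swap_apply_right]
      rw [← hv]; unfold slotVal; rw [if_neg (by rw [hslotk_par]; simp), hslotk_pos]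
  -- the pairs and the map
  set P := (A ×ˢ (Finset.univ : Finset (Fin (2 ^ n)))).filter
    (fun q ↦ slotk q.2 ∉ revSlots q.1 par c j ∧ q.2 ≠ kOf q.1) with hP
  let ψ : CycleDatum n × Fin (2 ^ n) → CycleDatum n × Fin (2 ^ n) := fun q ↦ (T q.1 (Equiv.swap (kOf q.1) q.2), kOf q.1)
  set Bad : CycleDatum n → Finset (Fin (2 ^ n)) := fun σ'' ↦ (revSlots σ'' par c j).biUnion fun y ↦
    (Finset.Icc (-(2 * t + 4 : ℤ)) (2 * t + 4)).image fun d : ℤ ↦ slotPos (y - (d : Slot n)) with hBad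
  set Side := Finset.univ.filter (fun σ : CycleDatum n ↦
    depth (pos σ par c (par.getD j 0)) = n ∧ (pos σ par c (par.getD j 0)).1 = b) with hSide
  set Tgt := (Side ×ˢ (Finset.univ : Finset (Fin (2 ^ n)))).filter (fun q ↦ q.2 ∈ Bad q.1) with hTgt
  -- (1) lower bound on `|P|`: every `σ ∈ A` has at least `2^n - 3t - 1` unread partner positions
  have hlow : A.card * (2 ^ n - (3 * t + 1)) ≤ P.card := by
    rw [hP, card_filter_prod_eq_sum]
    have hfib : ∀ σ ∈ A, 2 ^ n - (3 * t + 1) ≤ ((Finset.univ : Finset (Fin (2 ^ n))).filter fun k' ↦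
        slotk k' ∉ revSlots σ par c j ∧ k' ≠ kOf σ).card := by
      intro σ _
      have hbad : ((Finset.univ : Finset (Fin (2 ^ n))).filter fun k' ↦
          ¬ (slotk k' ∉ revSlots σ par c j ∧ k' ≠ kOf σ)).card ≤ 3 * t + 1 := by
        calc ((Finset.univ : Finset (Fin (2 ^ n))).filter fun k' ↦ ¬ (slotk k' ∉ revSlots σ par c j ∧ k' ≠ kOf σ)).card
            ≤ ((Finset.univ.filter fun k' : Fin (2 ^ n) ↦ slotk k' ∈ revSlots σ par c j) ∪ {kOf σ}).card := by
              apply Finset.card_le_card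
              intro k hk
              rw [Finset.mem_filter] at hk
              rw [Finset.mem_union, Finset.mem_filter, Finset.mem_singleton]
              by_cases h1 : slotk k ∈ revSlots σ par c j
              · exact Or.inl ⟨Finset.mem_univ _, h1⟩
              · right; by_contra h2; exact hk.2 ⟨h1, h2⟩
          _ ≤ (Finset.univ.filter fun k' : Fin (2 ^ n) ↦ slotk k' ∈ revSlots σ par c j).card + 1 :=
              (Finset.card_union_le _ _).trans (by simp)
          _ ≤ (revSlots σ par c j).card + 1 := by
              gcongr
              exact Finset.card_le_card_of_injOn slotk (fun k hk ↦ (Finset.mem_filter.mp hk).2)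
                (hslotk_inj.injOn)
          _ ≤ 3 * t + 1 := by have := card_revSlots_le σ par c j; omega
      have := Finset.card_filter_add_card_filter_not (s := (Finset.univ : Finset (Fin (2 ^ n))))
        (fun k' ↦ slotk k' ∉ revSlots σ par c j ∧ k' ≠ kOf σ)
      rw [Finset.card_univ, Fintype.card_fin] at this
      omega
    calc A.card * (2 ^ n - (3 * t + 1)) = ∑ _σ ∈ A, (2 ^ n - (3 * t + 1)) := by rw [Finset.sum_const, smul_eq_mul]
      _ ≤ _ := Finset.sum_le_sum hfib
  -- (2) `ψ` maps `P` injectively into `Tgt`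
  have hmaps : ∀ q ∈ P, ψ q ∈ Tgt := by
    rintro ⟨σ, k'⟩ hq
    rw [hP, Finset.mem_filter, Finset.mem_product] at hq
    obtain ⟨⟨hσ, -⟩, hk', -⟩ := hq
    obtain ⟨hdep, hside, -, -, y, hy, d, hd, hyd⟩ := hAmem σ hσ
    obtain ⟨hpos, hrev⟩ := hinv σ hσ k' hk'
    rw [hTgt, Finset.mem_filter]
    refine ⟨Finset.mem_product.mpr ⟨?_, Finset.mem_univ _⟩, ?_⟩
    · rw [hSide, Finset.mem_filter]
      refine ⟨Finset.mem_univ _, ?_⟩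
      show depth (pos (T σ (Equiv.swap (kOf σ) k')) par c (par.getD j 0)) = n ∧
        (pos (T σ (Equiv.swap (kOf σ) k')) par c (par.getD j 0)).1 = b
      rw [hpos _ hp_le]
      exact ⟨hdep, hside⟩
    show kOf σ ∈ Bad (T σ (Equiv.swap (kOf σ) k'))
    rw [hBad]
    simp only
    rw [hrev, Finset.mem_biUnion]
    refine ⟨y, hy, Finset.mem_image.mpr ⟨d, Finset.mem_Icc.mpr (abs_le.mp hd), ?_⟩⟩
    rw [hyd, add_sub_cancel_right, hslotk_pos]
  have hinj : Set.InjOn ψ ↑P := by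
    rintro ⟨σ₁, k₁⟩ hq₁ ⟨σ₂, k₂⟩ hq₂ heq
    simp only [Finset.mem_coe] at hq₁ hq₂
    rw [hP, Finset.mem_filter, Finset.mem_product] at hq₁ hq₂
    obtain ⟨⟨hσ₁, -⟩, hk₁, -⟩ := hq₁
    obtain ⟨⟨hσ₂, -⟩, hk₂, -⟩ := hq₂
    simp only [ψ, Prod.mk.injEq] at heq
    obtain ⟨hT, hkk⟩ := heq
    -- the expanded node is the same vertex for `σ₁`, `σ''`, `σ₂`
    have hv₁ := (hinv σ₁ hσ₁ k₁ hk₁).1 _ hp_le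
    have hv₂ := (hinv σ₂ hσ₂ k₂ hk₂).1 _ hp_le
    have hvv : pos σ₁ par c (par.getD j 0) = pos σ₂ par c (par.getD j 0) := by rw [← hv₁, ← hv₂, hT]
    -- hence the partner positions agree
    have hs₁ := hnewslot σ₁ hσ₁ k₁
    have hs₂ := hnewslot σ₂ hσ₂ k₂
    rw [hT, hvv, ← hs₂] at hs₁
    have hk12 : k₁ = k₂ := hslotk_inj (slotVal_injective _ hs₁)
    subst hk12
    -- and the data agree
    have hσσ : σ₁ = σ₂ := by
      rw [hkk] at hT
      simp only [T] at hT
      cases b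
      · simp only [Bool.false_eq_true, if_false, Prod.mk.injEq] at hT
        obtain ⟨h1, h2⟩ := hT
        have : σ₁.1 = σ₂.1 := by
          have := congrArg (fun e ↦ (Equiv.swap (kOf σ₂) k₁).symm.trans e) h1
          simpa [← Equiv.trans_assoc] using this
        exact Prod.ext this h2
      · simp only [if_true, Prod.mk.injEq] at hT
        obtain ⟨h1, h2⟩ := hT
        have : σ₁.2 = σ₂.2 := by
          have := congrArg (fun e ↦ (Equiv.swap (kOf σ₂) k₁).symm.trans e) h2
          simpa [← Equiv.trans_assoc] using this
        exact Prod.ext h1 this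
    rw [hσσ]
  have hPT : P.card ≤ Tgt.card := Finset.card_le_card_of_injOn ψ hmaps hinj
  -- (3) `|Tgt|` is small
  have hTgt_le : Tgt.card ≤ 3 * t * (4 * t + 9) * Side.card := by
    rw [hTgt, card_filter_prod_eq_sum]
    have : ∀ σ'' ∈ Side,
        ((Finset.univ : Finset (Fin (2 ^ n))).filter fun k ↦ (σ'', k).2 ∈ Bad (σ'', k).1).card ≤ 3 * t * (4 * t + 9) := by
      intro σ'' _
      calc ((Finset.univ : Finset (Fin (2 ^ n))).filter fun k ↦ k ∈ Bad σ'').card ≤ (Bad σ'').card :=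
            Finset.card_le_card fun k hk ↦ (Finset.mem_filter.mp hk).2
        _ ≤ (revSlots σ'' par c j).card * (4 * t + 9) := by
            rw [hBad]
            refine Finset.card_biUnion_le.trans ?_
            refine (Finset.sum_le_card_nsmul _ _ (4 * t + 9) ?_).trans (le_of_eq (smul_eq_mul _ _))
            intro y _
            have := card_near_le y (2 * t + 4)
            push_cast at this
            omega
        _ ≤ 3 * t * (4 * t + 9) := by
            have := card_revSlots_le σ'' par c j
            have : (revSlots σ'' par c j).card ≤ 3 * t := by omega
            exact Nat.mul_le_mul_right _ this
    refine (Finset.sum_le_sum this).trans ?_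
    rw [Finset.sum_const, smul_eq_mul, mul_comm]
  exact hlow.trans (hPT.trans hTgt_le)

/-- **The spread bound at one step (fixed coins).** `#{σ : BadSpread at step j} · (2^n - 3t - 1) ≤
3t(4t+9) · |Σ|`. [cite: ChildsEtAl2003, §4 (Lemma 8 (ii))] -/
theorem card_badSpread_step_mul_le (hn : 1 ≤ n) {par : List ℕ} (hval : ∀ i (h : i < par.length), par[i] ≤ 2 * i)
    (c : ℕ → Bool) {t : ℕ} (ht : par.length ≤ t) {j : ℕ} (hj : j < par.length) :
    (Finset.univ.filter fun σ : CycleDatum n ↦ BadSpread σ par c t j).card * (2 ^ n - (3 * t + 1)) ≤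
      3 * t * (4 * t + 9) * Fintype.card (CycleDatum n) := by
  have hsplit : (Finset.univ.filter fun σ : CycleDatum n ↦ BadSpread σ par c t j) =
      (Finset.univ.filter fun σ : CycleDatum n ↦ BadSpread σ par c t j ∧ (pos σ par c (par.getD j 0)).1 = false) ∪
      (Finset.univ.filter fun σ : CycleDatum n ↦ BadSpread σ par c t j ∧ (pos σ par c (par.getD j 0)).1 = true) := by
    ext σ; simp only [Finset.mem_filter, Finset.mem_univ, true_and, Finset.mem_union]
    cases (pos σ par c (par.getD j 0)).1 <;> simp
  have hsides : (Finset.univ.filter fun σ : CycleDatum n ↦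
        depth (pos σ par c (par.getD j 0)) = n ∧ (pos σ par c (par.getD j 0)).1 = false).card +
      (Finset.univ.filter fun σ : CycleDatum n ↦
        depth (pos σ par c (par.getD j 0)) = n ∧ (pos σ par c (par.getD j 0)).1 = true).card ≤
      Fintype.card (CycleDatum n) := by
    rw [← Finset.card_union_of_disjoint, ← Finset.card_univ]
    · exact Finset.card_le_univ _
    · rw [Finset.disjoint_left]
      intro σ h1 h2
      rw [Finset.mem_filter] at h1 h2
      rw [h1.2.2] at h2
      exact Bool.false_ne_true h2.2.2
  have h0 := card_badSpread_side_mul_le hn hval c ht hj false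
  have h1 := card_badSpread_side_mul_le hn hval c ht hj true
  rw [hsplit]
  calc _ ≤ ((Finset.univ.filter fun σ : CycleDatum n ↦ BadSpread σ par c t j ∧ (pos σ par c (par.getD j 0)).1 = false).card +
        (Finset.univ.filter fun σ : CycleDatum n ↦ BadSpread σ par c t j ∧ (pos σ par c (par.getD j 0)).1 = true).card) *
        (2 ^ n - (3 * t + 1)) := Nat.mul_le_mul_right _ (Finset.card_union_le _ _)
    _ ≤ _ := by rw [Nat.add_mul]; exact (Nat.add_le_add h0 h1).trans (by rw [← Nat.mul_add]; exact Nat.mul_le_mul_left _ hsides)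

/-- **The spread bound** (Lemma 8 (ii), slots): for a valid list with `E ≤ t` expansions,
`#{(c, σ) : BadSpread at some step} · (2^n - 3t - 1) ≤ E · 3t(4t+9) · 2^t · |Σ|`.
[cite: ChildsEtAl2003, §4 (Lemma 8 (ii))] -/
theorem card_badSpread_mul_le (hn : 1 ≤ n) {par : List ℕ} (hval : ∀ i (h : i < par.length), par[i] ≤ 2 * i)
    {t : ℕ} (ht : par.length ≤ t) :
    (Finset.univ.filter fun cσ : (Fin t → Bool) × CycleDatum n ↦
        ∃ j < par.length, BadSpread cσ.2 par (fun i ↦ if hi : i < t then cσ.1 ⟨i, hi⟩ else false) t j).card *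
        (2 ^ n - (3 * t + 1)) ≤
      par.length * (3 * t * (4 * t + 9)) * 2 ^ t * Fintype.card (CycleDatum n) := by
  calc (Finset.univ.filter fun cσ : (Fin t → Bool) × CycleDatum n ↦
        ∃ j < par.length, BadSpread cσ.2 par (fun i ↦ if hi : i < t then cσ.1 ⟨i, hi⟩ else false) t j).card *
        (2 ^ n - (3 * t + 1))
      ≤ (∑ j ∈ Finset.range par.length, (Finset.univ.filter fun cσ : (Fin t → Bool) × CycleDatum n ↦
          BadSpread cσ.2 par (fun i ↦ if hi : i < t then cσ.1 ⟨i, hi⟩ else false) t j).card) * (2 ^ n - (3 * t + 1)) := by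
        apply Nat.mul_le_mul_right
        refine (Finset.card_le_card ?_).trans Finset.card_biUnion_le
        intro cσ hc
        rw [Finset.mem_filter] at hc
        obtain ⟨j, hj, hjc⟩ := hc.2
        rw [Finset.mem_biUnion]
        exact ⟨j, Finset.mem_range.mpr hj, Finset.mem_filter.mpr ⟨Finset.mem_univ _, hjc⟩⟩
    _ = ∑ j ∈ Finset.range par.length, (Finset.univ.filter fun cσ : (Fin t → Bool) × CycleDatum n ↦
          BadSpread cσ.2 par (fun i ↦ if hi : i < t then cσ.1 ⟨i, hi⟩ else false) t j).card * (2 ^ n - (3 * t + 1)) := by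
        rw [Finset.sum_mul]
    _ ≤ ∑ _j ∈ Finset.range par.length, 3 * t * (4 * t + 9) * 2 ^ t * Fintype.card (CycleDatum n) := by
        apply Finset.sum_le_sum
        intro j hj
        rw [Finset.mem_range] at hj
        rw [card_filter_coins_eq_sum', Finset.sum_mul]
        calc ∑ c : Fin t → Bool, (Finset.univ.filter fun σ : CycleDatum n ↦
              BadSpread σ par (fun i ↦ if hi : i < t then c ⟨i, hi⟩ else false) t j).card * (2 ^ n - (3 * t + 1))
            ≤ ∑ _c : Fin t → Bool, 3 * t * (4 * t + 9) * Fintype.card (CycleDatum n) :=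
              Finset.sum_le_sum fun c _ ↦ card_badSpread_step_mul_le hn hval _ ht hj
          _ = 3 * t * (4 * t + 9) * 2 ^ t * Fintype.card (CycleDatum n) := by
              rw [Finset.sum_const, Finset.card_univ, smul_eq_mul, Fintype.card_fun, Fintype.card_fin,
                Fintype.card_bool]; ring
    _ = par.length * (3 * t * (4 * t + 9)) * 2 ^ t * Fintype.card (CycleDatum n) := by
        rw [Finset.sum_const, Finset.card_range, smul_eq_mul]; ring


/-! ### The block bound: preliminaries -/

/-- The touched blocks are few: at most `2j+1` from the existing nodes and `2E+1` from the
coin-only tree. [cite: ChildsEtAl2003, §4 (Lemma 8 (ii))] -/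
theorem card_occBlocks_le (σ : CycleDatum n) (par : List ℕ) (c : ℕ → Bool) (h j : ℕ) :
    (occBlocks σ par c h j).card ≤ (2 * j + 1) + (2 * par.length + 1) := by
  unfold occBlocks
  refine (Finset.card_union_le _ _).trans (Nat.add_le_add ?_ ?_)
  · refine Finset.card_image_le.trans ((Finset.card_filter_le _ _).trans ?_)
    rw [Finset.card_range]
  · refine Finset.card_image_le.trans ((Finset.card_filter_le _ _).trans ?_)
    rw [Finset.card_range]

/-- The touched blocks depend only on the first `2j+1` positions. [cite: ChildsEtAl2003, §4 (Lemma 8 (ii))] -/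
theorem occBlocks_congr {σ σ' : CycleDatum n} {par : List ℕ} {c : ℕ → Bool} (h : ℕ) {j : ℕ}
    (hpos : ∀ m ≤ 2 * j, pos σ' par c m = pos σ par c m) : occBlocks σ' par c h j = occBlocks σ par c h j := by
  unfold occBlocks
  congr 1
  have hfil : (Finset.range (2 * j + 1)).filter (fun m ↦ n + 1 - h ≤ depth (pos σ' par c m)) =
      (Finset.range (2 * j + 1)).filter (fun m ↦ n + 1 - h ≤ depth (pos σ par c m)) := by
    apply Finset.filter_congr
    intro m hm; rw [Finset.mem_range] at hm; rw [hpos m (by omega)]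
  rw [hfil]
  apply Finset.image_congr
  intro m hm
  rw [Finset.mem_coe, Finset.mem_filter, Finset.mem_range] at hm
  show blk h (pos σ' par c m) = blk h (pos σ par c m)
  rw [hpos m (by omega)]

/-- Leaf indices whose leaf (of side `b`) lies in one of the blocks of `BadB`: at most
`|BadB| · 2^(h-1)`. [cite: ChildsEtAl2003, §4 (Lemma 8 (ii): "`2^{n/2}/(2^n - t)`")] -/
theorem card_filter_blk_mem_le {h : ℕ} (hh : h ≤ n + 1) (BadB : Finset (Vertex n)) (b : Bool) :
    (Finset.univ.filter fun i : Fin (2 ^ n) ↦ blk h (if b then leafR n i else leafL n i) ∈ BadB).card ≤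
      BadB.card * 2 ^ (h - 1) := by
  calc (Finset.univ.filter fun i : Fin (2 ^ n) ↦ blk h (if b then leafR n i else leafL n i) ∈ BadB).card
      ≤ (BadB.biUnion fun B ↦ Finset.univ.filter fun i : Fin (2 ^ n) ↦ blk h (if b then leafR n i else leafL n i) = B).card := by
        apply Finset.card_le_card
        intro i hi
        rw [Finset.mem_filter] at hi
        rw [Finset.mem_biUnion]
        exact ⟨_, hi.2, Finset.mem_filter.mpr ⟨Finset.mem_univ _, rfl⟩⟩
    _ ≤ ∑ B ∈ BadB, (Finset.univ.filter fun i : Fin (2 ^ n) ↦ blk h (if b then leafR n i else leafL n i) = B).card :=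
        Finset.card_biUnion_le
    _ ≤ BadB.card * 2 ^ (h - 1) := by
        rw [← smul_eq_mul]
        exact Finset.sum_le_card_nsmul _ _ _ fun B _ ↦ card_leaves_blk_le hh B b

/-- The leaf in a slot, by cases on the parity. [folklore] -/
theorem slotVal_eq_ite (σ : CycleDatum n) (s : Slot n) :
    slotVal σ s = if s.val % 2 = 0 then leafL n (σ.1 (slotPos s)) else leafR n (σ.2 (slotPos s)) := rfl

/-- The slot of a leaf reads only the permutation of its own side. [folklore] -/
theorem slotOf_congr_of_side {σ σ' : CycleDatum n} {v : Vertex n} (h : if v.1 then σ'.2 = σ.2 else σ'.1 = σ.1) :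
    slotOf σ' v = slotOf σ v := by
  unfold slotOf
  split_ifs with hd hb <;> simp_all

/-! ### The block bound: a newly read neighbour hits a touched block -/

/-- **A newly read cross neighbour is a nearly uniform leaf (one offset, one side, one step,
fixed coins).** For a valid list with `E ≤ t` expansions, coins `c`, a step `j`, an offset `δ`
and a side `b`: the cycle data for which step `j` expands a node at a leaf of side `!b` whose
slot `x` has `x + δ` unread, of side `b`, holding a leaf whose block is touched, satisfy
`#A · (2^n - 3t - 1) ≤ (4t+2) 2^(h-1) · #Side`: re-randomising the leaf in slot `x + δ` by a
transposition with any unread leaf index of side `b` is invisible to the past.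
[cite: ChildsEtAl2003, §4 (Lemma 8 (ii))] -/
theorem card_badBlockOcc_side_mul_le (hn : 1 ≤ n) {par : List ℕ} (hval : ∀ i (h : i < par.length), par[i] ≤ 2 * i)
    (c : ℕ → Bool) {t : ℕ} (ht : par.length ≤ t) {h : ℕ} (hh : h ≤ n + 1) {j : ℕ} (hj : j < par.length)
    (δ : ℤ) (b : Bool) :
    (Finset.univ.filter fun σ : CycleDatum n ↦
        depth (pos σ par c (par.getD j 0)) = n ∧ (pos σ par c (par.getD j 0)).1 = !b ∧
        (slotOf σ (pos σ par c (par.getD j 0)) + δ).val % 2 = (if b then 1 else 0) ∧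
        slotOf σ (pos σ par c (par.getD j 0)) + δ ∉ revSlots σ par c j ∧
        blk h (slotVal σ (slotOf σ (pos σ par c (par.getD j 0)) + δ)) ∈ occBlocks σ par c h j).card *
        (2 ^ n - (3 * t + 1)) ≤
      (4 * t + 2) * 2 ^ (h - 1) * (Finset.univ.filter fun σ : CycleDatum n ↦
        depth (pos σ par c (par.getD j 0)) = n ∧ (pos σ par c (par.getD j 0)).1 = !b).card := by
  set A := Finset.univ.filter (fun σ : CycleDatum n ↦
        depth (pos σ par c (par.getD j 0)) = n ∧ (pos σ par c (par.getD j 0)).1 = !b ∧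
        (slotOf σ (pos σ par c (par.getD j 0)) + δ).val % 2 = (if b then 1 else 0) ∧
        slotOf σ (pos σ par c (par.getD j 0)) + δ ∉ revSlots σ par c j ∧
        blk h (slotVal σ (slotOf σ (pos σ par c (par.getD j 0)) + δ)) ∈ occBlocks σ par c h j) with hA
  set Side := Finset.univ.filter (fun σ : CycleDatum n ↦
        depth (pos σ par c (par.getD j 0)) = n ∧ (pos σ par c (par.getD j 0)).1 = !b) with hSide
  have hpj : par.getD j 0 = par[j] := by
    rw [List.getD_eq_getElem?_getD, List.getElem?_eq_getElem hj]; rfl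
  have hp_le : par.getD j 0 ≤ 2 * j := by rw [hpj]; exact hval j hj
  -- notation
  let T : CycleDatum n → Equiv.Perm (Fin (2 ^ n)) → CycleDatum n := fun σ ρ ↦
    if b then (σ.1, σ.2.trans ρ) else (σ.1.trans ρ, σ.2)
  let pm : CycleDatum n → Equiv.Perm (Fin (2 ^ n)) := fun σ ↦ if b then σ.2 else σ.1
  let yOf : CycleDatum n → Slot n := fun σ ↦ slotOf σ (pos σ par c (par.getD j 0)) + δ
  let iOf : CycleDatum n → Fin (2 ^ n) := fun σ ↦ pm σ (slotPos (yOf σ))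
  let leafb : Fin (2 ^ n) → Vertex n := fun i ↦ if b then leafR n i else leafL n i
  -- leaves in slots of side `b`
  have hval_b : ∀ (σ : CycleDatum n) (s : Slot n), s.val % 2 = (if b then 1 else 0) →
      slotVal σ s = leafb (pm σ (slotPos s)) := by
    intro σ s hs
    rw [slotVal_eq_ite]
    simp only [leafb, pm]
    cases b
    · simp only [Bool.false_eq_true, if_false] at hs ⊢; rw [if_pos hs]
    · simp only [if_true] at hs ⊢; rw [if_neg (by omega)]
  have hval_T : ∀ (σ : CycleDatum n) (ρ : Equiv.Perm (Fin (2 ^ n))) (s : Slot n), s.val % 2 = (if b then 1 else 0) →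
      slotVal (T σ ρ) s = leafb (ρ (pm σ (slotPos s))) := by
    intro σ ρ s hs
    simp only [T, leafb, pm]
    cases b
    · simp only [Bool.false_eq_true, if_false] at hs ⊢; rw [slotVal_postL, if_pos hs]
    · simp only [if_true] at hs ⊢; rw [slotVal_postR, if_neg (by omega)]
  have hpm_T : ∀ (σ : CycleDatum n) (ρ : Equiv.Perm (Fin (2 ^ n))), pm (T σ ρ) = (pm σ).trans ρ := by
    intro σ ρ; simp only [pm, T]; cases b <;> rfl
  have hslotOf_T : ∀ (σ : CycleDatum n) (ρ : Equiv.Perm (Fin (2 ^ n))) (v : Vertex n), v.1 = !b →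
      slotOf (T σ ρ) v = slotOf σ v := by
    intro σ ρ v hv
    apply slotOf_congr_of_side
    simp only [T]; rw [hv]; cases b <;> simp
  have hleafb_inj : Function.Injective leafb := by
    intro i i' hii'; simp only [leafb] at hii'
    cases b
    · exact leafL_injective hii'
    · exact leafR_injective hii'
  -- key facts for `σ ∈ A`
  have hAmem : ∀ σ ∈ A, depth (pos σ par c (par.getD j 0)) = n ∧ (pos σ par c (par.getD j 0)).1 = !b ∧
      (yOf σ).val % 2 = (if b then 1 else 0) ∧ yOf σ ∉ revSlots σ par c j ∧
      blk h (leafb (iOf σ)) ∈ occBlocks σ par c h j := by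
    intro σ hσ
    rw [hA, Finset.mem_filter] at hσ
    obtain ⟨-, hd, hside, hpar, hnot, hblk⟩ := hσ
    refine ⟨hd, hside, hpar, hnot, ?_⟩
    rwa [hval_b σ _ hpar] at hblk
  -- re-randomising the value in the unread slot is invisible
  have hinv : ∀ σ ∈ A, ∀ i' : Fin (2 ^ n),
      (∀ s ∈ revSlots σ par c j, s.val % 2 = (if b then 1 else 0) → pm σ (slotPos s) ≠ i') →
      (∀ m ≤ 2 * j, pos (T σ (Equiv.swap (iOf σ) i')) par c m = pos σ par c m) ∧
      revSlots (T σ (Equiv.swap (iOf σ) i')) par c j = revSlots σ par c j := by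
    intro σ hσ i' hi'
    obtain ⟨hd, hside, hpar, hnot, -⟩ := hAmem σ hσ
    have hfix : ∀ s ∈ revSlots σ par c j, s.val % 2 = (if b then 1 else 0) →
        Equiv.swap (iOf σ) i' (pm σ (slotPos s)) = pm σ (slotPos s) := by
      intro s hs hspar
      apply Equiv.swap_apply_of_ne_of_ne
      · -- a read slot of side `b` is not `y`, so its value is not `iOf σ`
        intro heq
        have hpos : slotPos s = slotPos (yOf σ) := (pm σ).injective heq
        have : s = yOf σ := by
          cases b
          · simp only [Bool.false_eq_true, if_false] at hspar hpar
            rw [slot_eq_two_mul_of_even hspar, slot_eq_two_mul_of_even hpar, hpos]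
          · simp only [if_true] at hspar hpar
            rw [slot_eq_two_mul_add_one_of_odd (by omega : s.val % 2 ≠ 0),
              slot_eq_two_mul_add_one_of_odd (by omega : (yOf σ).val % 2 ≠ 0), hpos]
        exact hnot (this ▸ hs)
      · exact hi' s hs hspar
    have hagree : ∀ s ∈ revSlots σ par c j, slotVal (T σ (Equiv.swap (iOf σ) i')) s = slotVal σ s := by
      simp only [T]
      cases b
      · simp only [Bool.false_eq_true, if_false]
        refine slotVal_postL_eq_of_fix σ _ _ fun s hs hspar ↦ ?_
        have := hfix s hs (by simp [hspar])
        simpa [pm] using this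
      · simp only [if_true]
        refine slotVal_postR_eq_of_fix σ _ _ fun s hs hspar ↦ ?_
        have := hfix s hs (by simp; omega)
        simpa [pm] using this
    obtain ⟨h1, h2⟩ := pos_revSlots_congr hn hval c σ _ j hj.le hagree
    exact ⟨h1, h2 j le_rfl⟩
  -- admissible partners: unread values of side `b`, other than `iOf σ`
  set ReadVals : CycleDatum n → Finset (Fin (2 ^ n)) := fun σ ↦
    ((revSlots σ par c j).filter fun s ↦ s.val % 2 = (if b then 1 else 0)).image fun s ↦ pm σ (slotPos s) with hRV
  have hRV_card : ∀ σ, (ReadVals σ).card ≤ 3 * t := by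
    intro σ
    refine Finset.card_image_le.trans ((Finset.card_filter_le _ _).trans ?_)
    have := card_revSlots_le σ par c j; omega
  have hRV_spec : ∀ σ (i' : Fin (2 ^ n)), i' ∉ ReadVals σ →
      ∀ s ∈ revSlots σ par c j, s.val % 2 = (if b then 1 else 0) → pm σ (slotPos s) ≠ i' := by
    intro σ i' hi' s hs hspar heq
    apply hi'
    rw [hRV, Finset.mem_image]
    exact ⟨s, Finset.mem_filter.mpr ⟨hs, hspar⟩, heq⟩
  -- pairs, map, target
  set P := (A ×ˢ (Finset.univ : Finset (Fin (2 ^ n)))).filter (fun q ↦ q.2 ∉ ReadVals q.1 ∧ q.2 ≠ iOf q.1) with hP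
  let ψ : CycleDatum n × Fin (2 ^ n) → CycleDatum n × Fin (2 ^ n) := fun q ↦ (T q.1 (Equiv.swap (iOf q.1) q.2), iOf q.1)
  set Tgt := (Side ×ˢ (Finset.univ : Finset (Fin (2 ^ n)))).filter
    (fun q ↦ blk h (leafb q.2) ∈ occBlocks q.1 par c h j) with hTgt
  -- (1) lower bound
  have hlow : A.card * (2 ^ n - (3 * t + 1)) ≤ P.card := by
    rw [hP, card_filter_prod_eq_sum]
    have hfib : ∀ σ ∈ A, 2 ^ n - (3 * t + 1) ≤ ((Finset.univ : Finset (Fin (2 ^ n))).filter fun i' ↦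
        i' ∉ ReadVals σ ∧ i' ≠ iOf σ).card := by
      intro σ _
      have hbad : ((Finset.univ : Finset (Fin (2 ^ n))).filter fun i' ↦ ¬ (i' ∉ ReadVals σ ∧ i' ≠ iOf σ)).card ≤ 3 * t + 1 := by
        calc _ ≤ (ReadVals σ ∪ {iOf σ}).card := by
              apply Finset.card_le_card
              intro i hi
              rw [Finset.mem_filter] at hi
              rw [Finset.mem_union, Finset.mem_singleton]
              by_cases h1 : i ∈ ReadVals σ
              · exact Or.inl h1
              · right; by_contra h2; exact hi.2 ⟨h1, h2⟩
          _ ≤ (ReadVals σ).card + 1 := (Finset.card_union_le _ _).trans (by simp)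
          _ ≤ 3 * t + 1 := by have := hRV_card σ; omega
      have := Finset.card_filter_add_card_filter_not (s := (Finset.univ : Finset (Fin (2 ^ n))))
        (fun i' ↦ i' ∉ ReadVals σ ∧ i' ≠ iOf σ)
      rw [Finset.card_univ, Fintype.card_fin] at this
      omega
    calc A.card * (2 ^ n - (3 * t + 1)) = ∑ _σ ∈ A, (2 ^ n - (3 * t + 1)) := by rw [Finset.sum_const, smul_eq_mul]
      _ ≤ _ := Finset.sum_le_sum hfib
  -- (2) `ψ` maps `P` injectively into `Tgt`
  have hmaps : ∀ q ∈ P, ψ q ∈ Tgt := by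
    rintro ⟨σ, i'⟩ hq
    rw [hP, Finset.mem_filter, Finset.mem_product] at hq
    obtain ⟨⟨hσ, -⟩, hi', -⟩ := hq
    obtain ⟨hdep, hside, -, -, hblk⟩ := hAmem σ hσ
    obtain ⟨hpos, -⟩ := hinv σ hσ i' (hRV_spec σ i' hi')
    rw [hTgt, Finset.mem_filter]
    refine ⟨Finset.mem_product.mpr ⟨?_, Finset.mem_univ _⟩, ?_⟩
    · rw [hSide, Finset.mem_filter]
      refine ⟨Finset.mem_univ _, ?_⟩
      show depth (pos (T σ (Equiv.swap (iOf σ) i')) par c (par.getD j 0)) = n ∧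
        (pos (T σ (Equiv.swap (iOf σ) i')) par c (par.getD j 0)).1 = !b
      rw [hpos _ hp_le]
      exact ⟨hdep, hside⟩
    · show blk h (leafb (iOf σ)) ∈ occBlocks (T σ (Equiv.swap (iOf σ) i')) par c h j
      rwa [occBlocks_congr h hpos]
  have hinj : Set.InjOn ψ ↑P := by
    rintro ⟨σ₁, i₁⟩ hq₁ ⟨σ₂, i₂⟩ hq₂ heq
    simp only [Finset.mem_coe] at hq₁ hq₂
    rw [hP, Finset.mem_filter, Finset.mem_product] at hq₁ hq₂
    obtain ⟨⟨hσ₁, -⟩, hi₁, -⟩ := hq₁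
    obtain ⟨⟨hσ₂, -⟩, hi₂, -⟩ := hq₂
    simp only [ψ, Prod.mk.injEq] at heq
    obtain ⟨hT, hii⟩ := heq
    obtain ⟨hd₁, hs₁, hpar₁, -, -⟩ := hAmem σ₁ hσ₁
    obtain ⟨hd₂, hs₂, hpar₂, -, -⟩ := hAmem σ₂ hσ₂
    have hv₁ := (hinv σ₁ hσ₁ i₁ (hRV_spec σ₁ i₁ hi₁)).1 _ hp_le
    have hv₂ := (hinv σ₂ hσ₂ i₂ (hRV_spec σ₂ i₂ hi₂)).1 _ hp_le
    have hvv : pos σ₁ par c (par.getD j 0) = pos σ₂ par c (par.getD j 0) := by rw [← hv₁, ← hv₂, hT]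
    -- the slots `y` agree
    have hyy : yOf σ₁ = yOf σ₂ := by
      show slotOf σ₁ (pos σ₁ par c (par.getD j 0)) + δ = slotOf σ₂ (pos σ₂ par c (par.getD j 0)) + δ
      rw [← hslotOf_T σ₁ (Equiv.swap (iOf σ₁) i₁) _ hs₁, ← hslotOf_T σ₂ (Equiv.swap (iOf σ₂) i₂) _ hs₂, hT, hvv]
    -- the new values agree
    have hn₁ := hval_T σ₁ (Equiv.swap (iOf σ₁) i₁) (yOf σ₁) hpar₁
    have hn₂ := hval_T σ₂ (Equiv.swap (iOf σ₂) i₂) (yOf σ₂) hpar₂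
    rw [hT, hyy, hn₂] at hn₁
    have h12 := hleafb_inj hn₁
    simp only [iOf] at h12 hii
    rw [Equiv.swap_apply_left, hyy, Equiv.swap_apply_left] at h12
    -- so `i₁ = i₂`, the transpositions agree, and the data agree
    subst h12
    have hσσ : σ₁ = σ₂ := by
      rw [show (iOf σ₁ : Fin (2 ^ n)) = iOf σ₂ from hii] at hT
      simp only [T] at hT
      cases b
      · simp only [Bool.false_eq_true, if_false, Prod.mk.injEq] at hT
        obtain ⟨h1, h2⟩ := hT
        have : σ₁.1 = σ₂.1 := by
          have := congrArg (fun e ↦ e.trans (Equiv.swap (iOf σ₂) i₂).symm) h1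
          simpa [Equiv.trans_assoc] using this
        exact Prod.ext this h2
      · simp only [if_true, Prod.mk.injEq] at hT
        obtain ⟨h1, h2⟩ := hT
        have : σ₁.2 = σ₂.2 := by
          have := congrArg (fun e ↦ e.trans (Equiv.swap (iOf σ₂) i₂).symm) h2
          simpa [Equiv.trans_assoc] using this
        exact Prod.ext h1 this
    rw [hσσ]
  have hPT : P.card ≤ Tgt.card := Finset.card_le_card_of_injOn ψ hmaps hinj
  -- (3) `|Tgt|` is small
  have hTgt_le : Tgt.card ≤ (4 * t + 2) * 2 ^ (h - 1) * Side.card := by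
    rw [hTgt, card_filter_prod_eq_sum]
    have : ∀ σ'' ∈ Side, ((Finset.univ : Finset (Fin (2 ^ n))).filter fun i ↦
        blk h (leafb (σ'', i).2) ∈ occBlocks (σ'', i).1 par c h j).card ≤ (4 * t + 2) * 2 ^ (h - 1) := by
      intro σ'' _
      calc ((Finset.univ : Finset (Fin (2 ^ n))).filter fun i ↦ blk h (leafb i) ∈ occBlocks σ'' par c h j).card
          ≤ (occBlocks σ'' par c h j).card * 2 ^ (h - 1) := card_filter_blk_mem_le hh _ b
        _ ≤ (4 * t + 2) * 2 ^ (h - 1) := by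
            apply Nat.mul_le_mul_right
            have := card_occBlocks_le σ'' par c h j
            omega
    refine (Finset.sum_le_sum this).trans ?_
    rw [Finset.sum_const, smul_eq_mul, mul_comm]
  exact hlow.trans (hPT.trans hTgt_le)

/-! ### The block bound: the two newly read neighbours share a block -/

/-- In `ZMod 2^{n+1}` with `1 ≤ n`, `x + 1 ≠ x - 1`. [folklore] -/
theorem slot_add_one_ne_sub_one (hn : 1 ≤ n) (x : Slot n) : x + 1 ≠ x - 1 := by
  intro h
  have h2 : (2 : Slot n) = 0 := by
    have := congrArg (fun y ↦ y - x + 1) h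
    have e1 : x + 1 - x + 1 = (2 : Slot n) := by ring
    have e2 : x - 1 - x + 1 = (0 : Slot n) := by ring
    have h' : x + 1 - x + 1 = x - 1 - x + 1 := this
    rwa [e1, e2] at h'
  have h4 : 4 ≤ 2 ^ (n + 1) := by
    calc 4 = 2 ^ 2 := rfl
      _ ≤ 2 ^ (n + 1) := Nat.pow_le_pow_right two_pos (by omega)
  have := (slot_natCast_inj (n := n) (m := 2) (m' := 0) (by omega) (by omega)).mp (by push_cast; exact h2)
  omega

/-- **The two newly read cross neighbours rarely share a block (one side, one step, fixed
coins).** For a valid list with `E ≤ t` expansions, coins `c`, a step `j` and a side `b`: the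
cycle data for which step `j` expands a node at a leaf of side `!b` whose slot `x` has both
`x + 1`, `x - 1` unread (of side `b`) holding leaves of the same block satisfy
`#A · (2^n - 3t - 2) ≤ 2^(h-1) · #Side`: re-randomise the leaf in slot `x - 1` keeping the one in
`x + 1`. [cite: ChildsEtAl2003, §4 (Lemma 8 (ii))] -/
theorem card_badBlockEq_side_mul_le (hn : 1 ≤ n) {par : List ℕ} (hval : ∀ i (h : i < par.length), par[i] ≤ 2 * i)
    (c : ℕ → Bool) {t : ℕ} (ht : par.length ≤ t) {h : ℕ} (hh : h ≤ n + 1) {j : ℕ} (hj : j < par.length) (b : Bool) :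
    (Finset.univ.filter fun σ : CycleDatum n ↦
        depth (pos σ par c (par.getD j 0)) = n ∧ (pos σ par c (par.getD j 0)).1 = !b ∧
        (slotOf σ (pos σ par c (par.getD j 0)) - 1).val % 2 = (if b then 1 else 0) ∧
        (slotOf σ (pos σ par c (par.getD j 0)) + 1).val % 2 = (if b then 1 else 0) ∧
        slotOf σ (pos σ par c (par.getD j 0)) + 1 ∉ revSlots σ par c j ∧
        slotOf σ (pos σ par c (par.getD j 0)) - 1 ∉ revSlots σ par c j ∧
        blk h (slotVal σ (slotOf σ (pos σ par c (par.getD j 0)) - 1)) =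
          blk h (slotVal σ (slotOf σ (pos σ par c (par.getD j 0)) + 1))).card *
        (2 ^ n - (3 * t + 2)) ≤
      2 ^ (h - 1) * (Finset.univ.filter fun σ : CycleDatum n ↦
        depth (pos σ par c (par.getD j 0)) = n ∧ (pos σ par c (par.getD j 0)).1 = !b).card := by
  set A := Finset.univ.filter (fun σ : CycleDatum n ↦
        depth (pos σ par c (par.getD j 0)) = n ∧ (pos σ par c (par.getD j 0)).1 = !b ∧
        (slotOf σ (pos σ par c (par.getD j 0)) - 1).val % 2 = (if b then 1 else 0) ∧
        (slotOf σ (pos σ par c (par.getD j 0)) + 1).val % 2 = (if b then 1 else 0) ∧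
        slotOf σ (pos σ par c (par.getD j 0)) + 1 ∉ revSlots σ par c j ∧
        slotOf σ (pos σ par c (par.getD j 0)) - 1 ∉ revSlots σ par c j ∧
        blk h (slotVal σ (slotOf σ (pos σ par c (par.getD j 0)) - 1)) =
          blk h (slotVal σ (slotOf σ (pos σ par c (par.getD j 0)) + 1))) with hA
  set Side := Finset.univ.filter (fun σ : CycleDatum n ↦
        depth (pos σ par c (par.getD j 0)) = n ∧ (pos σ par c (par.getD j 0)).1 = !b) with hSide
  have hpj : par.getD j 0 = par[j] := by
    rw [List.getD_eq_getElem?_getD, List.getElem?_eq_getElem hj]; rfl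
  have hp_le : par.getD j 0 ≤ 2 * j := by rw [hpj]; exact hval j hj
  -- notation
  let T : CycleDatum n → Equiv.Perm (Fin (2 ^ n)) → CycleDatum n := fun σ ρ ↦
    if b then (σ.1, σ.2.trans ρ) else (σ.1.trans ρ, σ.2)
  let pm : CycleDatum n → Equiv.Perm (Fin (2 ^ n)) := fun σ ↦ if b then σ.2 else σ.1
  let yOf : CycleDatum n → Slot n := fun σ ↦ slotOf σ (pos σ par c (par.getD j 0)) - 1
  let zOf : CycleDatum n → Slot n := fun σ ↦ slotOf σ (pos σ par c (par.getD j 0)) + 1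
  let iOf : CycleDatum n → Fin (2 ^ n) := fun σ ↦ pm σ (slotPos (yOf σ))
  let izOf : CycleDatum n → Fin (2 ^ n) := fun σ ↦ pm σ (slotPos (zOf σ))
  let leafb : Fin (2 ^ n) → Vertex n := fun i ↦ if b then leafR n i else leafL n i
  have hval_b : ∀ (σ : CycleDatum n) (s : Slot n), s.val % 2 = (if b then 1 else 0) →
      slotVal σ s = leafb (pm σ (slotPos s)) := by
    intro σ s hs
    rw [slotVal_eq_ite]
    simp only [leafb, pm]
    cases b
    · simp only [Bool.false_eq_true, if_false] at hs ⊢; rw [if_pos hs]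
    · simp only [if_true] at hs ⊢; rw [if_neg (by omega)]
  have hval_T : ∀ (σ : CycleDatum n) (ρ : Equiv.Perm (Fin (2 ^ n))) (s : Slot n), s.val % 2 = (if b then 1 else 0) →
      slotVal (T σ ρ) s = leafb (ρ (pm σ (slotPos s))) := by
    intro σ ρ s hs
    simp only [T, leafb, pm]
    cases b
    · simp only [Bool.false_eq_true, if_false] at hs ⊢; rw [slotVal_postL, if_pos hs]
    · simp only [if_true] at hs ⊢; rw [slotVal_postR, if_neg (by omega)]
  have hslotOf_T : ∀ (σ : CycleDatum n) (ρ : Equiv.Perm (Fin (2 ^ n))) (v : Vertex n), v.1 = !b →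
      slotOf (T σ ρ) v = slotOf σ v := by
    intro σ ρ v hv
    apply slotOf_congr_of_side
    simp only [T]; rw [hv]; cases b <;> simp
  have hleafb_inj : Function.Injective leafb := by
    intro i i' hii'; simp only [leafb] at hii'
    cases b
    · exact leafL_injective hii'
    · exact leafR_injective hii'
  -- same-parity slots with equal positions are equal
  have hslot_eq_of_pos : ∀ s s' : Slot n, s.val % 2 = (if b then 1 else 0) → s'.val % 2 = (if b then 1 else 0) →
      slotPos s = slotPos s' → s = s' := by
    intro s s' hs hs' hpos
    cases b
    · simp only [Bool.false_eq_true, if_false] at hs hs'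
      rw [slot_eq_two_mul_of_even hs, slot_eq_two_mul_of_even hs', hpos]
    · simp only [if_true] at hs hs'
      rw [slot_eq_two_mul_add_one_of_odd (by omega : s.val % 2 ≠ 0),
        slot_eq_two_mul_add_one_of_odd (by omega : s'.val % 2 ≠ 0), hpos]
  -- key facts for `σ ∈ A`
  have hAmem : ∀ σ ∈ A, depth (pos σ par c (par.getD j 0)) = n ∧ (pos σ par c (par.getD j 0)).1 = !b ∧
      (yOf σ).val % 2 = (if b then 1 else 0) ∧ (zOf σ).val % 2 = (if b then 1 else 0) ∧
      zOf σ ∉ revSlots σ par c j ∧ yOf σ ∉ revSlots σ par c j ∧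
      blk h (leafb (iOf σ)) = blk h (slotVal σ (zOf σ)) ∧ iOf σ ≠ izOf σ := by
    intro σ hσ
    rw [hA, Finset.mem_filter] at hσ
    obtain ⟨-, hd, hside, hpy, hpz, hnz, hny, hblk⟩ := hσ
    refine ⟨hd, hside, hpy, hpz, hnz, hny, by rwa [hval_b σ _ hpy] at hblk, ?_⟩
    intro heq
    have hpos : slotPos (yOf σ) = slotPos (zOf σ) := (pm σ).injective heq
    have := hslot_eq_of_pos _ _ hpy hpz hpos
    exact slot_add_one_ne_sub_one hn _ this.symm
  -- re-randomising the value in slot `y` is invisible, and keeps the value in slot `z`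
  have hinv : ∀ σ ∈ A, ∀ i' : Fin (2 ^ n),
      (∀ s ∈ revSlots σ par c j, s.val % 2 = (if b then 1 else 0) → pm σ (slotPos s) ≠ i') → i' ≠ izOf σ →
      (∀ m ≤ 2 * j, pos (T σ (Equiv.swap (iOf σ) i')) par c m = pos σ par c m) ∧
      revSlots (T σ (Equiv.swap (iOf σ) i')) par c j = revSlots σ par c j ∧
      slotVal (T σ (Equiv.swap (iOf σ) i')) (zOf σ) = slotVal σ (zOf σ) := by
    intro σ hσ i' hi' hiz
    obtain ⟨hd, hside, hpy, hpz, hnz, hny, -, hyz⟩ := hAmem σ hσ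
    have hfix : ∀ s ∈ revSlots σ par c j, s.val % 2 = (if b then 1 else 0) →
        Equiv.swap (iOf σ) i' (pm σ (slotPos s)) = pm σ (slotPos s) := by
      intro s hs hspar
      apply Equiv.swap_apply_of_ne_of_ne
      · intro heq
        have hpos : slotPos s = slotPos (yOf σ) := (pm σ).injective heq
        exact hny (hslot_eq_of_pos _ _ hspar hpy hpos ▸ hs)
      · exact hi' s hs hspar
    have hagree : ∀ s ∈ revSlots σ par c j, slotVal (T σ (Equiv.swap (iOf σ) i')) s = slotVal σ s := by
      simp only [T]
      cases b
      · simp only [Bool.false_eq_true, if_false]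
        refine slotVal_postL_eq_of_fix σ _ _ fun s hs hspar ↦ ?_
        have := hfix s hs (by simp [hspar])
        simpa [pm] using this
      · simp only [if_true]
        refine slotVal_postR_eq_of_fix σ _ _ fun s hs hspar ↦ ?_
        have := hfix s hs (by simp; omega)
        simpa [pm] using this
    obtain ⟨h1, h2⟩ := pos_revSlots_congr hn hval c σ _ j hj.le hagree
    refine ⟨h1, h2 j le_rfl, ?_⟩
    rw [hval_T σ _ _ hpz, hval_b σ _ hpz]
    congr 1
    exact Equiv.swap_apply_of_ne_of_ne hyz.symm hiz.symm
  -- admissible partners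
  set ReadVals : CycleDatum n → Finset (Fin (2 ^ n)) := fun σ ↦
    ((revSlots σ par c j).filter fun s ↦ s.val % 2 = (if b then 1 else 0)).image fun s ↦ pm σ (slotPos s) with hRV
  have hRV_card : ∀ σ, (ReadVals σ).card ≤ 3 * t := by
    intro σ
    refine Finset.card_image_le.trans ((Finset.card_filter_le _ _).trans ?_)
    have := card_revSlots_le σ par c j; omega
  have hRV_spec : ∀ σ (i' : Fin (2 ^ n)), i' ∉ ReadVals σ →
      ∀ s ∈ revSlots σ par c j, s.val % 2 = (if b then 1 else 0) → pm σ (slotPos s) ≠ i' := by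
    intro σ i' hi' s hs hspar heq
    apply hi'
    rw [hRV, Finset.mem_image]
    exact ⟨s, Finset.mem_filter.mpr ⟨hs, hspar⟩, heq⟩
  set P := (A ×ˢ (Finset.univ : Finset (Fin (2 ^ n)))).filter
    (fun q ↦ q.2 ∉ ReadVals q.1 ∧ q.2 ≠ iOf q.1 ∧ q.2 ≠ izOf q.1) with hP
  let ψ : CycleDatum n × Fin (2 ^ n) → CycleDatum n × Fin (2 ^ n) := fun q ↦ (T q.1 (Equiv.swap (iOf q.1) q.2), iOf q.1)
  set Tgt := (Side ×ˢ (Finset.univ : Finset (Fin (2 ^ n)))).filter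
    (fun q ↦ blk h (leafb q.2) = blk h (slotVal q.1 (slotOf q.1 (pos q.1 par c (par.getD j 0)) + 1))) with hTgt
  -- (1) lower bound
  have hlow : A.card * (2 ^ n - (3 * t + 2)) ≤ P.card := by
    rw [hP, card_filter_prod_eq_sum]
    have hfib : ∀ σ ∈ A, 2 ^ n - (3 * t + 2) ≤ ((Finset.univ : Finset (Fin (2 ^ n))).filter fun i' ↦
        i' ∉ ReadVals σ ∧ i' ≠ iOf σ ∧ i' ≠ izOf σ).card := by
      intro σ _
      have hbad : ((Finset.univ : Finset (Fin (2 ^ n))).filter fun i' ↦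
          ¬ (i' ∉ ReadVals σ ∧ i' ≠ iOf σ ∧ i' ≠ izOf σ)).card ≤ 3 * t + 2 := by
        calc _ ≤ (ReadVals σ ∪ {iOf σ, izOf σ}).card := by
              apply Finset.card_le_card
              intro i hi
              rw [Finset.mem_filter] at hi
              rw [Finset.mem_union, Finset.mem_insert, Finset.mem_singleton]
              by_cases h1 : i ∈ ReadVals σ
              · exact Or.inl h1
              · right; by_contra h2; push Not at h2; exact hi.2 ⟨h1, h2.1, h2.2⟩
          _ ≤ (ReadVals σ).card + 2 := (Finset.card_union_le _ _).trans (by gcongr; exact Finset.card_le_two)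
          _ ≤ 3 * t + 2 := by have := hRV_card σ; omega
      have := Finset.card_filter_add_card_filter_not (s := (Finset.univ : Finset (Fin (2 ^ n))))
        (fun i' ↦ i' ∉ ReadVals σ ∧ i' ≠ iOf σ ∧ i' ≠ izOf σ)
      rw [Finset.card_univ, Fintype.card_fin] at this
      omega
    calc A.card * (2 ^ n - (3 * t + 2)) = ∑ _σ ∈ A, (2 ^ n - (3 * t + 2)) := by rw [Finset.sum_const, smul_eq_mul]
      _ ≤ _ := Finset.sum_le_sum hfib
  -- (2) `ψ` maps `P` injectively into `Tgt`
  have hmaps : ∀ q ∈ P, ψ q ∈ Tgt := by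
    rintro ⟨σ, i'⟩ hq
    rw [hP, Finset.mem_filter, Finset.mem_product] at hq
    obtain ⟨⟨hσ, -⟩, hi', -, hiz⟩ := hq
    obtain ⟨hdep, hside, -, -, -, -, hblk, -⟩ := hAmem σ hσ
    obtain ⟨hpos, -, hz⟩ := hinv σ hσ i' (hRV_spec σ i' hi') hiz
    rw [hTgt, Finset.mem_filter]
    refine ⟨Finset.mem_product.mpr ⟨?_, Finset.mem_univ _⟩, ?_⟩
    · rw [hSide, Finset.mem_filter]
      refine ⟨Finset.mem_univ _, ?_⟩
      show depth (pos (T σ (Equiv.swap (iOf σ) i')) par c (par.getD j 0)) = n ∧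
        (pos (T σ (Equiv.swap (iOf σ) i')) par c (par.getD j 0)).1 = !b
      rw [hpos _ hp_le]
      exact ⟨hdep, hside⟩
    · show blk h (leafb (iOf σ)) = blk h (slotVal (T σ (Equiv.swap (iOf σ) i'))
        (slotOf (T σ (Equiv.swap (iOf σ) i')) (pos (T σ (Equiv.swap (iOf σ) i')) par c (par.getD j 0)) + 1))
      rw [hpos _ hp_le, hslotOf_T σ _ _ hside]
      rw [hblk]
      exact congrArg (blk h) hz.symm
  have hinj : Set.InjOn ψ ↑P := by
    rintro ⟨σ₁, i₁⟩ hq₁ ⟨σ₂, i₂⟩ hq₂ heq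
    simp only [Finset.mem_coe] at hq₁ hq₂
    rw [hP, Finset.mem_filter, Finset.mem_product] at hq₁ hq₂
    obtain ⟨⟨hσ₁, -⟩, hi₁, -, hiz₁⟩ := hq₁
    obtain ⟨⟨hσ₂, -⟩, hi₂, -, hiz₂⟩ := hq₂
    simp only [ψ, Prod.mk.injEq] at heq
    obtain ⟨hT, hii⟩ := heq
    obtain ⟨hd₁, hs₁, hpar₁, -, -, -, -, -⟩ := hAmem σ₁ hσ₁
    obtain ⟨hd₂, hs₂, hpar₂, -, -, -, -, -⟩ := hAmem σ₂ hσ₂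
    have hv₁ := (hinv σ₁ hσ₁ i₁ (hRV_spec σ₁ i₁ hi₁) hiz₁).1 _ hp_le
    have hv₂ := (hinv σ₂ hσ₂ i₂ (hRV_spec σ₂ i₂ hi₂) hiz₂).1 _ hp_le
    have hvv : pos σ₁ par c (par.getD j 0) = pos σ₂ par c (par.getD j 0) := by rw [← hv₁, ← hv₂, hT]
    have hyy : yOf σ₁ = yOf σ₂ := by
      show slotOf σ₁ (pos σ₁ par c (par.getD j 0)) - 1 = slotOf σ₂ (pos σ₂ par c (par.getD j 0)) - 1
      rw [← hslotOf_T σ₁ (Equiv.swap (iOf σ₁) i₁) _ hs₁, ← hslotOf_T σ₂ (Equiv.swap (iOf σ₂) i₂) _ hs₂, hT, hvv]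
    have hn₁ := hval_T σ₁ (Equiv.swap (iOf σ₁) i₁) (yOf σ₁) hpar₁
    have hn₂ := hval_T σ₂ (Equiv.swap (iOf σ₂) i₂) (yOf σ₂) hpar₂
    rw [hT, hyy, hn₂] at hn₁
    have h12 := hleafb_inj hn₁
    simp only [iOf] at h12 hii
    rw [Equiv.swap_apply_left, hyy, Equiv.swap_apply_left] at h12
    subst h12
    have hσσ : σ₁ = σ₂ := by
      rw [show (iOf σ₁ : Fin (2 ^ n)) = iOf σ₂ from hii] at hT
      simp only [T] at hT
      cases b
      · simp only [Bool.false_eq_true, if_false, Prod.mk.injEq] at hT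
        obtain ⟨h1, h2⟩ := hT
        have : σ₁.1 = σ₂.1 := by
          have := congrArg (fun e ↦ e.trans (Equiv.swap (iOf σ₂) i₂).symm) h1
          simpa [Equiv.trans_assoc] using this
        exact Prod.ext this h2
      · simp only [if_true, Prod.mk.injEq] at hT
        obtain ⟨h1, h2⟩ := hT
        have : σ₁.2 = σ₂.2 := by
          have := congrArg (fun e ↦ e.trans (Equiv.swap (iOf σ₂) i₂).symm) h2
          simpa [Equiv.trans_assoc] using this
        exact Prod.ext h1 this
    rw [hσσ]
  have hPT : P.card ≤ Tgt.card := Finset.card_le_card_of_injOn ψ hmaps hinj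
  -- (3) `|Tgt|` is small: one block per `σ''`
  have hTgt_le : Tgt.card ≤ 2 ^ (h - 1) * Side.card := by
    rw [hTgt, card_filter_prod_eq_sum]
    have : ∀ σ'' ∈ Side, ((Finset.univ : Finset (Fin (2 ^ n))).filter fun i ↦
        blk h (leafb (σ'', i).2) = blk h (slotVal (σ'', i).1 (slotOf (σ'', i).1 (pos (σ'', i).1 par c (par.getD j 0)) + 1))).card ≤
        2 ^ (h - 1) := fun σ'' _ ↦ card_leaves_blk_le hh (blk h (slotVal σ'' (slotOf σ'' (pos σ'' par c (par.getD j 0)) + 1))) b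
    refine (Finset.sum_le_sum this).trans ?_
    rw [Finset.sum_const, smul_eq_mul, mul_comm]
  exact hlow.trans (hPT.trans hTgt_le)

/-! ### The block bound: assembly -/

/-- Consecutive slots have opposite parities (the modulus `2^{n+1}` is even). [folklore] -/
theorem slot_add_one_val_mod_two (x : Slot n) : (x + 1).val % 2 ≠ x.val % 2 := by
  haveI : Fact (1 < 2 ^ (n + 1)) := ⟨Nat.one_lt_two_pow (Nat.succ_ne_zero n)⟩
  rw [ZMod.val_add, ZMod.val_one]
  have hx := x.val_lt
  have heven : 2 ∣ 2 ^ (n + 1) := ⟨2 ^ n, Nat.pow_succ'⟩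
  rcases Nat.lt_or_ge (x.val + 1) (2 ^ (n + 1)) with hlt | hge
  · rw [Nat.mod_eq_of_lt hlt]; omega
  · have heq : x.val + 1 = 2 ^ (n + 1) := by omega
    rw [heq, Nat.mod_self]
    obtain ⟨k, hk⟩ := heven
    omega

/-- The previous slot has the opposite parity. [folklore] -/
theorem slot_sub_one_val_mod_two (x : Slot n) : (x - 1).val % 2 ≠ x.val % 2 := by
  have := slot_add_one_val_mod_two (x - 1)
  rw [sub_add_cancel] at this
  exact fun h ↦ this h.symm

/-- The two side-filters partition a subset of `Σ`. [folklore] -/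
theorem card_side_filters_le (par : List ℕ) (c : ℕ → Bool) (j : ℕ) :
    (Finset.univ.filter fun σ : CycleDatum n ↦
        depth (pos σ par c (par.getD j 0)) = n ∧ (pos σ par c (par.getD j 0)).1 = !false).card +
      (Finset.univ.filter fun σ : CycleDatum n ↦
        depth (pos σ par c (par.getD j 0)) = n ∧ (pos σ par c (par.getD j 0)).1 = !true).card ≤
      Fintype.card (CycleDatum n) := by
  rw [← Finset.card_union_of_disjoint, ← Finset.card_univ]
  · exact Finset.card_le_univ _
  · rw [Finset.disjoint_left]
    intro σ h1 h2
    rw [Finset.mem_filter] at h1 h2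
    rw [h1.2.2] at h2
    simp at h2

/-- **The block bound at one step (fixed coins).**
`#{σ : BadBlock at step j} · (2^n - 3t - 2) ≤ (8t+5) · 2^(h-1) · |Σ|`. [cite: ChildsEtAl2003, §4 (Lemma 8 (ii))] -/
theorem card_badBlock_step_mul_le (hn : 1 ≤ n) {par : List ℕ} (hval : ∀ i (h : i < par.length), par[i] ≤ 2 * i)
    (c : ℕ → Bool) {t : ℕ} (ht : par.length ≤ t) {h : ℕ} (hh : h ≤ n + 1) {j : ℕ} (hj : j < par.length) :
    (Finset.univ.filter fun σ : CycleDatum n ↦ BadBlock σ par c h j).card * (2 ^ n - (3 * t + 2)) ≤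
      (8 * t + 5) * 2 ^ (h - 1) * Fintype.card (CycleDatum n) := by
  -- the three sub-events, each split by the side `b` of the newly read slot
  have hcov : ∀ σ : CycleDatum n, BadBlock σ par c h j → ∃ b : Bool,
      (depth (pos σ par c (par.getD j 0)) = n ∧ (pos σ par c (par.getD j 0)).1 = !b ∧
        (slotOf σ (pos σ par c (par.getD j 0)) + 1).val % 2 = (if b then 1 else 0) ∧
        slotOf σ (pos σ par c (par.getD j 0)) + 1 ∉ revSlots σ par c j ∧
        blk h (slotVal σ (slotOf σ (pos σ par c (par.getD j 0)) + 1)) ∈ occBlocks σ par c h j) ∨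
      (depth (pos σ par c (par.getD j 0)) = n ∧ (pos σ par c (par.getD j 0)).1 = !b ∧
        (slotOf σ (pos σ par c (par.getD j 0)) + (-1 : ℤ)).val % 2 = (if b then 1 else 0) ∧
        slotOf σ (pos σ par c (par.getD j 0)) + (-1 : ℤ) ∉ revSlots σ par c j ∧
        blk h (slotVal σ (slotOf σ (pos σ par c (par.getD j 0)) + (-1 : ℤ))) ∈ occBlocks σ par c h j) ∨
      (depth (pos σ par c (par.getD j 0)) = n ∧ (pos σ par c (par.getD j 0)).1 = !b ∧
        (slotOf σ (pos σ par c (par.getD j 0)) - 1).val % 2 = (if b then 1 else 0) ∧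
        (slotOf σ (pos σ par c (par.getD j 0)) + 1).val % 2 = (if b then 1 else 0) ∧
        slotOf σ (pos σ par c (par.getD j 0)) + 1 ∉ revSlots σ par c j ∧
        slotOf σ (pos σ par c (par.getD j 0)) - 1 ∉ revSlots σ par c j ∧
        blk h (slotVal σ (slotOf σ (pos σ par c (par.getD j 0)) - 1)) =
          blk h (slotVal σ (slotOf σ (pos σ par c (par.getD j 0)) + 1))) := by
    intro σ hbad
    obtain ⟨hd, hcl⟩ := hbad
    set v := pos σ par c (par.getD j 0) with hv
    set x := slotOf σ v with hx
    have hxpar : x.val % 2 = (if v.1 then 1 else 0) := slotOf_val_mod_two σ hd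
    have hp1 : (x + 1).val % 2 = (if !v.1 then 1 else 0) := by
      have := slot_add_one_val_mod_two x
      cases hb : v.1 <;> rw [hb] at hxpar <;> simp at hxpar ⊢ <;> omega
    have hm1 : (x - 1).val % 2 = (if !v.1 then 1 else 0) := by
      have := slot_sub_one_val_mod_two x
      cases hb : v.1 <;> rw [hb] at hxpar <;> simp at hxpar ⊢ <;> omega
    have hcast : x + ((1 : ℤ) : Slot n) = x + 1 := by push_cast; ring
    have hcast' : x + ((-1 : ℤ) : Slot n) = x - 1 := by push_cast; ring
    refine ⟨!v.1, ?_⟩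
    have hside : v.1 = !!v.1 := by simp
    rcases hcl with ⟨y, hy, hblk⟩ | ⟨hn1, hn2, heq⟩
    · rw [Finset.mem_sdiff, Finset.mem_insert, Finset.mem_singleton] at hy
      obtain ⟨rfl | rfl, hny⟩ := hy
      · exact Or.inl ⟨hd, hside, hp1, hny, hblk⟩
      · refine Or.inr (Or.inl ⟨hd, hside, ?_, ?_, ?_⟩)
        · rw [show (x + (-1 : ℤ) : Slot n) = x - 1 by push_cast; ring]; exact hm1
        · rw [show (x + (-1 : ℤ) : Slot n) = x - 1 by push_cast; ring]; exact hny
        · rw [show (x + (-1 : ℤ) : Slot n) = x - 1 by push_cast; ring]; exact hblk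
    · exact Or.inr (Or.inr ⟨hd, hside, hm1, hp1, hn1, hn2, heq.symm⟩)
  -- the union bound
  have hD : 2 ^ n - (3 * t + 2) ≤ 2 ^ n - (3 * t + 1) := by omega
  -- abbreviations for the six filtered sets
  have key : ∀ b : Bool,
      ((Finset.univ.filter fun σ : CycleDatum n ↦
        depth (pos σ par c (par.getD j 0)) = n ∧ (pos σ par c (par.getD j 0)).1 = !b ∧
        (slotOf σ (pos σ par c (par.getD j 0)) + ((1 : ℤ) : Slot n)).val % 2 = (if b then 1 else 0) ∧
        slotOf σ (pos σ par c (par.getD j 0)) + ((1 : ℤ) : Slot n) ∉ revSlots σ par c j ∧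
        blk h (slotVal σ (slotOf σ (pos σ par c (par.getD j 0)) + ((1 : ℤ) : Slot n))) ∈ occBlocks σ par c h j).card +
      (Finset.univ.filter fun σ : CycleDatum n ↦
        depth (pos σ par c (par.getD j 0)) = n ∧ (pos σ par c (par.getD j 0)).1 = !b ∧
        (slotOf σ (pos σ par c (par.getD j 0)) + ((-1 : ℤ) : Slot n)).val % 2 = (if b then 1 else 0) ∧
        slotOf σ (pos σ par c (par.getD j 0)) + ((-1 : ℤ) : Slot n) ∉ revSlots σ par c j ∧
        blk h (slotVal σ (slotOf σ (pos σ par c (par.getD j 0)) + ((-1 : ℤ) : Slot n))) ∈ occBlocks σ par c h j).card +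
      (Finset.univ.filter fun σ : CycleDatum n ↦
        depth (pos σ par c (par.getD j 0)) = n ∧ (pos σ par c (par.getD j 0)).1 = !b ∧
        (slotOf σ (pos σ par c (par.getD j 0)) - 1).val % 2 = (if b then 1 else 0) ∧
        (slotOf σ (pos σ par c (par.getD j 0)) + 1).val % 2 = (if b then 1 else 0) ∧
        slotOf σ (pos σ par c (par.getD j 0)) + 1 ∉ revSlots σ par c j ∧
        slotOf σ (pos σ par c (par.getD j 0)) - 1 ∉ revSlots σ par c j ∧
        blk h (slotVal σ (slotOf σ (pos σ par c (par.getD j 0)) - 1)) =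
          blk h (slotVal σ (slotOf σ (pos σ par c (par.getD j 0)) + 1))).card) * (2 ^ n - (3 * t + 2)) ≤
      (8 * t + 5) * 2 ^ (h - 1) * (Finset.univ.filter fun σ : CycleDatum n ↦
        depth (pos σ par c (par.getD j 0)) = n ∧ (pos σ par c (par.getD j 0)).1 = !b).card := by
    intro b
    have h1 := card_badBlockOcc_side_mul_le hn hval c ht hh hj (1 : ℤ) b
    have h2 := card_badBlockOcc_side_mul_le hn hval c ht hh hj (-1 : ℤ) b
    have h3 := card_badBlockEq_side_mul_le hn hval c ht hh hj b
    rw [Nat.add_mul, Nat.add_mul]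
    have h1' := (Nat.mul_le_mul_left _ hD).trans h1
    have h2' := (Nat.mul_le_mul_left _ hD).trans h2
    calc _ ≤ (4 * t + 2) * 2 ^ (h - 1) * _ + (4 * t + 2) * 2 ^ (h - 1) * _ + 2 ^ (h - 1) * _ :=
          Nat.add_le_add (Nat.add_le_add h1' h2') h3
      _ = _ := by ring
  -- cover and count
  calc (Finset.univ.filter fun σ : CycleDatum n ↦ BadBlock σ par c h j).card * (2 ^ n - (3 * t + 2))
      ≤ (∑ b : Bool, ((Finset.univ.filter fun σ : CycleDatum n ↦
        depth (pos σ par c (par.getD j 0)) = n ∧ (pos σ par c (par.getD j 0)).1 = !b ∧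
        (slotOf σ (pos σ par c (par.getD j 0)) + ((1 : ℤ) : Slot n)).val % 2 = (if b then 1 else 0) ∧
        slotOf σ (pos σ par c (par.getD j 0)) + ((1 : ℤ) : Slot n) ∉ revSlots σ par c j ∧
        blk h (slotVal σ (slotOf σ (pos σ par c (par.getD j 0)) + ((1 : ℤ) : Slot n))) ∈ occBlocks σ par c h j).card +
      (Finset.univ.filter fun σ : CycleDatum n ↦
        depth (pos σ par c (par.getD j 0)) = n ∧ (pos σ par c (par.getD j 0)).1 = !b ∧
        (slotOf σ (pos σ par c (par.getD j 0)) + ((-1 : ℤ) : Slot n)).val % 2 = (if b then 1 else 0) ∧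
        slotOf σ (pos σ par c (par.getD j 0)) + ((-1 : ℤ) : Slot n) ∉ revSlots σ par c j ∧
        blk h (slotVal σ (slotOf σ (pos σ par c (par.getD j 0)) + ((-1 : ℤ) : Slot n))) ∈ occBlocks σ par c h j).card +
      (Finset.univ.filter fun σ : CycleDatum n ↦
        depth (pos σ par c (par.getD j 0)) = n ∧ (pos σ par c (par.getD j 0)).1 = !b ∧
        (slotOf σ (pos σ par c (par.getD j 0)) - 1).val % 2 = (if b then 1 else 0) ∧
        (slotOf σ (pos σ par c (par.getD j 0)) + 1).val % 2 = (if b then 1 else 0) ∧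
        slotOf σ (pos σ par c (par.getD j 0)) + 1 ∉ revSlots σ par c j ∧
        slotOf σ (pos σ par c (par.getD j 0)) - 1 ∉ revSlots σ par c j ∧
        blk h (slotVal σ (slotOf σ (pos σ par c (par.getD j 0)) - 1)) =
          blk h (slotVal σ (slotOf σ (pos σ par c (par.getD j 0)) + 1))).card)) * (2 ^ n - (3 * t + 2)) := by
        apply Nat.mul_le_mul_right
        -- every bad `σ` lies in one of the six sets
        have hsub : (Finset.univ.filter fun σ : CycleDatum n ↦ BadBlock σ par c h j) ⊆
            (Finset.univ : Finset Bool).biUnion fun b ↦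
              ((Finset.univ.filter fun σ : CycleDatum n ↦
                depth (pos σ par c (par.getD j 0)) = n ∧ (pos σ par c (par.getD j 0)).1 = !b ∧
                (slotOf σ (pos σ par c (par.getD j 0)) + ((1 : ℤ) : Slot n)).val % 2 = (if b then 1 else 0) ∧
                slotOf σ (pos σ par c (par.getD j 0)) + ((1 : ℤ) : Slot n) ∉ revSlots σ par c j ∧
                blk h (slotVal σ (slotOf σ (pos σ par c (par.getD j 0)) + ((1 : ℤ) : Slot n))) ∈ occBlocks σ par c h j) ∪
              (Finset.univ.filter fun σ : CycleDatum n ↦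
                depth (pos σ par c (par.getD j 0)) = n ∧ (pos σ par c (par.getD j 0)).1 = !b ∧
                (slotOf σ (pos σ par c (par.getD j 0)) + ((-1 : ℤ) : Slot n)).val % 2 = (if b then 1 else 0) ∧
                slotOf σ (pos σ par c (par.getD j 0)) + ((-1 : ℤ) : Slot n) ∉ revSlots σ par c j ∧
                blk h (slotVal σ (slotOf σ (pos σ par c (par.getD j 0)) + ((-1 : ℤ) : Slot n))) ∈ occBlocks σ par c h j) ∪
              (Finset.univ.filter fun σ : CycleDatum n ↦
                depth (pos σ par c (par.getD j 0)) = n ∧ (pos σ par c (par.getD j 0)).1 = !b ∧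
                (slotOf σ (pos σ par c (par.getD j 0)) - 1).val % 2 = (if b then 1 else 0) ∧
                (slotOf σ (pos σ par c (par.getD j 0)) + 1).val % 2 = (if b then 1 else 0) ∧
                slotOf σ (pos σ par c (par.getD j 0)) + 1 ∉ revSlots σ par c j ∧
                slotOf σ (pos σ par c (par.getD j 0)) - 1 ∉ revSlots σ par c j ∧
                blk h (slotVal σ (slotOf σ (pos σ par c (par.getD j 0)) - 1)) =
                  blk h (slotVal σ (slotOf σ (pos σ par c (par.getD j 0)) + 1)))) := by
          intro σ hσ
          rw [Finset.mem_filter] at hσ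
          obtain ⟨b, hb⟩ := hcov σ hσ.2
          rw [Finset.mem_biUnion]
          refine ⟨b, Finset.mem_univ _, ?_⟩
          rw [Finset.mem_union, Finset.mem_union, Finset.mem_filter, Finset.mem_filter, Finset.mem_filter]
          have hc1 : ((1 : ℤ) : Slot n) = 1 := by push_cast; ring
          rw [hc1]
          rcases hb with hb | hb | hb
          · exact Or.inl (Or.inl ⟨Finset.mem_univ _, hb⟩)
          · exact Or.inl (Or.inr ⟨Finset.mem_univ _, hb⟩)
          · exact Or.inr ⟨Finset.mem_univ _, hb⟩
        refine (Finset.card_le_card hsub).trans (Finset.card_biUnion_le.trans (Finset.sum_le_sum fun b _ ↦ ?_))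
        exact (Finset.card_union_le _ _).trans (Nat.add_le_add_right (Finset.card_union_le _ _) _)
    _ ≤ ∑ b : Bool, (8 * t + 5) * 2 ^ (h - 1) * (Finset.univ.filter fun σ : CycleDatum n ↦
        depth (pos σ par c (par.getD j 0)) = n ∧ (pos σ par c (par.getD j 0)).1 = !b).card := by
        rw [Finset.sum_mul]; exact Finset.sum_le_sum fun b _ ↦ key b
    _ ≤ (8 * t + 5) * 2 ^ (h - 1) * Fintype.card (CycleDatum n) := by
        rw [← Finset.mul_sum]
        apply Nat.mul_le_mul_left
        rw [Fintype.sum_bool]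
        have := card_side_filters_le (n := n) par c j
        omega

/-- **The block bound** (Lemma 8 (ii), leaves): for a valid list with `E ≤ t` expansions,
`#{(c, σ) : BadBlock at some step} · (2^n - 3t - 2) ≤ E · (8t+5) · 2^(h-1) · 2^t · |Σ|`.
[cite: ChildsEtAl2003, §4 (Lemma 8 (ii))] -/
theorem card_badBlock_mul_le (hn : 1 ≤ n) {par : List ℕ} (hval : ∀ i (h : i < par.length), par[i] ≤ 2 * i)
    {t : ℕ} (ht : par.length ≤ t) {h : ℕ} (hh : h ≤ n + 1) :
    (Finset.univ.filter fun cσ : (Fin t → Bool) × CycleDatum n ↦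
        ∃ j < par.length, BadBlock cσ.2 par (fun i ↦ if hi : i < t then cσ.1 ⟨i, hi⟩ else false) h j).card *
        (2 ^ n - (3 * t + 2)) ≤
      par.length * ((8 * t + 5) * 2 ^ (h - 1)) * 2 ^ t * Fintype.card (CycleDatum n) := by
  calc (Finset.univ.filter fun cσ : (Fin t → Bool) × CycleDatum n ↦
        ∃ j < par.length, BadBlock cσ.2 par (fun i ↦ if hi : i < t then cσ.1 ⟨i, hi⟩ else false) h j).card *
        (2 ^ n - (3 * t + 2))
      ≤ (∑ j ∈ Finset.range par.length, (Finset.univ.filter fun cσ : (Fin t → Bool) × CycleDatum n ↦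
          BadBlock cσ.2 par (fun i ↦ if hi : i < t then cσ.1 ⟨i, hi⟩ else false) h j).card) * (2 ^ n - (3 * t + 2)) := by
        apply Nat.mul_le_mul_right
        refine (Finset.card_le_card ?_).trans Finset.card_biUnion_le
        intro cσ hc
        rw [Finset.mem_filter] at hc
        obtain ⟨j, hj, hjc⟩ := hc.2
        rw [Finset.mem_biUnion]
        exact ⟨j, Finset.mem_range.mpr hj, Finset.mem_filter.mpr ⟨Finset.mem_univ _, hjc⟩⟩
    _ = ∑ j ∈ Finset.range par.length, (Finset.univ.filter fun cσ : (Fin t → Bool) × CycleDatum n ↦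
          BadBlock cσ.2 par (fun i ↦ if hi : i < t then cσ.1 ⟨i, hi⟩ else false) h j).card * (2 ^ n - (3 * t + 2)) := by
        rw [Finset.sum_mul]
    _ ≤ ∑ _j ∈ Finset.range par.length, (8 * t + 5) * 2 ^ (h - 1) * 2 ^ t * Fintype.card (CycleDatum n) := by
        apply Finset.sum_le_sum
        intro j hj
        rw [Finset.mem_range] at hj
        rw [card_filter_coins_eq_sum', Finset.sum_mul]
        calc ∑ c : Fin t → Bool, (Finset.univ.filter fun σ : CycleDatum n ↦
              BadBlock σ par (fun i ↦ if hi : i < t then c ⟨i, hi⟩ else false) h j).card * (2 ^ n - (3 * t + 2))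
            ≤ ∑ _c : Fin t → Bool, (8 * t + 5) * 2 ^ (h - 1) * Fintype.card (CycleDatum n) :=
              Finset.sum_le_sum fun c _ ↦ card_badBlock_step_mul_le hn hval _ ht hh hj
          _ = (8 * t + 5) * 2 ^ (h - 1) * 2 ^ t * Fintype.card (CycleDatum n) := by
              rw [Finset.sum_const, Finset.card_univ, smul_eq_mul, Fintype.card_fun, Fintype.card_fin,
                Fintype.card_bool]; ring
    _ = par.length * ((8 * t + 5) * 2 ^ (h - 1)) * 2 ^ t * Fintype.card (CycleDatum n) := by
        rw [Finset.sum_const, Finset.card_range, smul_eq_mul]; ring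
end GluedTrees

end Literature.Computability.QuantumComplexity
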